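/-
Copyright (c) 2026 the pub-hodgecm-mathlib formalisation cell (harness21).  Prover seat hodgecm-mathlib-B-p14 (g38), 2026-09-01.  «S3-ram» seeding wave (LEAD F0P3a-plan (g12)
T11-61; architect A-p16 (g31) «want» 22:33:05Z; owner F0P3a-p06 (g15)): the SPAN IDENTITIES of the certificates «P-1-ram profiles» (fe5c0753 ∕ a002a20e) and «P-2-ram profiles» (b8cfb164).
-/
import Mathlib.Data.Complex.Basic
import Mathlib.Algebra.Ring.GeomSum
import Mathlib.Algebra.BigOperators.Intervals
import Mathlib.Tactic
import HarnessLib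

/-!
# The depth-zero `5×2` transfer matrix at a TAMELY RAMIFIED place as identities of closed forms: `X̃_j(N) = M_{j,0}·Y₀(N) + M_{j,1}·Y₁(N)` (Rogawski 1990 §4.9; Labesse–Langlands 1979 §2)

Topic `NumberTheory/Rogawski1990`; namespace `Literature.NumberTheory.Rogawski1990`; the RAMIFIED twin of ★ `DepthZeroTransferMatrixIdentity` ∕ `…TypeTwo` ∕ `…Levi` (inert, 3 strata,
F0P3b-p01 (g11)) — here 5 strata and the `(EDGES, VERTICES)` H-basis of the ramified `U(1,1)`-tree.  THEOREMS ONLY (no definition, no instance, no notation, no named fact, no `sorry`); pure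
arithmetic over `ℂ` with `q : ℕ` (in the application `q = N𝔭_v`).  Cell `pub/hodgecm-mathlib` (D-0151), crux H413 = `stmt-HodgeConjecture-24833`, road «S3-ram», fold v6 socket
`stub_levelOneRowsRam` :118, P-1-ram skeleton (α) v3 (A-p16 (g31)) STUB C′ :165 and P-2-ram skeleton (α₂) v0.2 (A-p12 (g23)) STUB C₂′ :143.  HONEST LABEL: HC_CM is proved only modulo
the 2 remaining named inputs (hLiu418 24832, h413 24833) until rung 0 closes; this file is count-neutral arithmetic — it is the `field_simp` residue of the span stubs ONCE the G-side
(A′∕A₂) and H-side (B′∕B₂) closed forms are typed in the normal forms below.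

THE MATHEMATICS.  At a tame-ramified non-split place `v` (`w ∣ v`, `q = N𝔭_v = N𝔓_w`) the exact certificates of seat B-p14 (g38) (HOME `F0/P3a/B-p14/g38/P1ram/`, `…/P2ram/`; evidence on
24833) computed, for the five `v`-level-1 strata `j ∈ {bd, reg, 1⁺, 1⁻, 0}` of `K₀ ∕ K(ϖ_w²) = O₃(𝔽_q) ⋉ 𝔭`, the κ-signed normalised G-side profiles `X̃_j(N)` of a deep elliptic `γ_H` and
the stable H-side profiles `(Y₀, Y₁)(N)` = (# fixed self-dual EDGE midpoints, # fixed ϖ-modular VERTICES) of the ramified `U(1,1)`-tree, and found ONE matrix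
`M(q) = ((−2∕q, (q+1)∕q), (−2∕q², (q+1)∕q²), ((q²+q−1)∕q³, −(q+1)(2q−1)∕(2q³)) ×2, (2∕q³, −1∕q³))` with `X̃_j = M_{j,0}Y₀ + M_{j,1}Y₁` on all four populations of :118 —
type (1) (`N = 2n+1`; `Y₀ = 4Σ_{k≤n}q^k − 2`, `Y₁ = 4Σ_{k≤n}q^k` = ★ `hProfile_zero∕one_closedForm_of_odd` of `DepthZeroTransferHValuesRamifiedClosedForms`, both H-classes summed;
`X̃ = (4qⁿ, 4qⁿ⁻¹, 2(qⁿ−q−1)∕q², 2(qⁿ−q−1)∕q², 4(qⁿ−1)∕((q−1)q²))`), type (2r) (`N = 2n+1`, one H-class: halves), type (2u) (`N = 2n`: `Y = ((q+1)T, 1 + (q+1)T)`, `T = Σ_{k<n}q^k`;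
`X̃ = ((q+1)qⁿ∕q, (q+1)qⁿ∕q², (q+1)(qⁿ−2q)∕(2q³) ×2, ((q+1)T − 1)∕q³)`) and Levi (per axis period both H-columns equal, so only the row sums `M_{j,0} + M_{j,1} =
((1−q⁻¹), q⁻¹(1−q⁻¹), ½q⁻²(1−q⁻¹) ×2, q⁻³)` = the `N`-strata volumes of ★ `integral_eq_of_levelTwo_strata_of_ramified` enter).  This file states and proves exactly these
identities (§1 type (1), division-free forms and `M`-forms; §2 type (2r); §3 type (2u); §4 the Levi row sums and the column sums `(0, 1)` = the fundamental-lemma check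
`Σ_j X̃_j = Y₁`).  Every proof is `geom_sum_mul` + `field_simp`∕`linear_combination`∕`ring`.

## References
* [Rogawski1990] J. D. Rogawski, *Automorphic Representations of Unitary Groups in Three Variables*, Ann. of Math. Stud. 123 (1990), §4.9 pp. 54–56 (transfer of the unit and of
  level pieces at non-split places), Prop. 8.1.1 p. 112.
* [LabesseLanglands1979] J.-P. Labesse, R. P. Langlands, *L-indistinguishability for SL(2)*, Canad. J. Math. 31 (1979), §2 p. 8 (fixed-point counts of elliptic tori in the tree).
-/

set_option autoImplicit false

open Finset

namespace Literature.NumberTheory.Rogawski1990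

/-! ## §0 The geometric-sum bookkeeping used throughout -/

/-- `(q − 1)·Σ_{k ≤ n} q^k = q^{n+1} − 1` in `ℂ` (Mathlib's `geom_sum_mul`, oriented for `linear_combination`). [cite: LabesseLanglands1979, §2 p. 8] -/
theorem sub_one_mul_geom_sum_range_succ (q n : ℕ) :
    ((q : ℂ) - 1) * ∑ k ∈ range (n + 1), (q : ℂ) ^ k = (q : ℂ) ^ (n + 1) - 1 := by
  rw [mul_comm]; exact geom_sum_mul (q : ℂ) (n + 1)

/-- `Σ_{k ≤ n} q^k = 1 + q·Σ_{k < n} q^k` in `ℂ`. [cite: LabesseLanglands1979, §2 p. 8] -/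
theorem geom_sum_range_succ_eq_one_add_mul (q n : ℕ) :
    ∑ k ∈ range (n + 1), (q : ℂ) ^ k = 1 + (q : ℂ) * ∑ k ∈ range n, (q : ℂ) ^ k := by
  rw [sum_range_succ', pow_zero, mul_sum]
  simp only [pow_succ]
  ring

/-! ## §1 Type (1) (`N = 2n+1`, both H-classes summed): `Y₀ = 4S − 2`, `Y₁ = 4S`, `S = Σ_{k ≤ n} q^k` -/

/-- **bd row, division-free**: `q·X̃_bd = −2·Y₀ + (q+1)·Y₁` with `X̃_bd = 4qⁿ`. [cite: Rogawski1990, §4.9 pp. 54–56] -/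
theorem span_typeOne_bd_mul (q n : ℕ) :
    (q : ℂ) * (4 * (q : ℂ) ^ n) =
      (-2) * (4 * (∑ k ∈ range (n + 1), (q : ℂ) ^ k) - 2) + ((q : ℂ) + 1) * (4 * ∑ k ∈ range (n + 1), (q : ℂ) ^ k) := by
  have h := sub_one_mul_geom_sum_range_succ q n
  linear_combination (-4) * h

/-- **bd row, `M`-form** (`q ≠ 0`): `4qⁿ = (−2∕q)·Y₀ + ((q+1)∕q)·Y₁`. [cite: Rogawski1990, §4.9 pp. 54–56] -/
theorem span_typeOne_bd {q : ℕ} (hq : q ≠ 0) (n : ℕ) :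
    (4 * (q : ℂ) ^ n) =
      (-2 / (q : ℂ)) * (4 * (∑ k ∈ range (n + 1), (q : ℂ) ^ k) - 2) + (((q : ℂ) + 1) / q) * (4 * ∑ k ∈ range (n + 1), (q : ℂ) ^ k) := by
  have hq' : (q : ℂ) ≠ 0 := Nat.cast_ne_zero.mpr hq
  have h := span_typeOne_bd_mul q n
  field_simp
  linear_combination h

/-- **reg row, division-free** (`1 ≤ n`): `q²·X̃_reg = −2·Y₀ + (q+1)·Y₁` with `X̃_reg = 4qⁿ⁻¹`. [cite: Rogawski1990, §4.9 pp. 54–56] -/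
theorem span_typeOne_reg_mul (q : ℕ) {n : ℕ} (hn : 1 ≤ n) :
    (q : ℂ) ^ 2 * (4 * (q : ℂ) ^ (n - 1)) =
      (-2) * (4 * (∑ k ∈ range (n + 1), (q : ℂ) ^ k) - 2) + ((q : ℂ) + 1) * (4 * ∑ k ∈ range (n + 1), (q : ℂ) ^ k) := by
  obtain ⟨m, rfl⟩ := Nat.exists_eq_add_of_le hn
  have h := sub_one_mul_geom_sum_range_succ q (1 + m)
  rw [show 1 + m - 1 = m from by omega]
  rw [show 1 + m + 1 = m + 2 from by omega] at h ⊢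
  linear_combination (-4) * h

/-- **reg row, `M`-form** (`q ≠ 0`, `1 ≤ n`): `4qⁿ⁻¹ = (−2∕q²)·Y₀ + ((q+1)∕q²)·Y₁`. [cite: Rogawski1990, §4.9 pp. 54–56] -/
theorem span_typeOne_reg {q : ℕ} (hq : q ≠ 0) {n : ℕ} (hn : 1 ≤ n) :
    (4 * (q : ℂ) ^ (n - 1)) =
      (-2 / (q : ℂ) ^ 2) * (4 * (∑ k ∈ range (n + 1), (q : ℂ) ^ k) - 2) + (((q : ℂ) + 1) / (q : ℂ) ^ 2) * (4 * ∑ k ∈ range (n + 1), (q : ℂ) ^ k) := by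
  have hq' : (q : ℂ) ≠ 0 := Nat.cast_ne_zero.mpr hq
  have h := span_typeOne_reg_mul q hn
  field_simp
  linear_combination h

/-- **collar rows `1⁺ = 1⁻`, division-free**: `4q·(qⁿ − q − 1) = 2(q²+q−1)·Y₀ − (q+1)(2q−1)·Y₁` (i.e. `2q³·X̃_{1±}` with `X̃_{1±} = 2(qⁿ−q−1)∕q²`). [cite: Rogawski1990, §4.9 pp. 54–56] -/
theorem span_typeOne_collar_mul (q n : ℕ) :
    4 * (q : ℂ) * ((q : ℂ) ^ n - q - 1) =
      2 * ((q : ℂ) ^ 2 + q - 1) * (4 * (∑ k ∈ range (n + 1), (q : ℂ) ^ k) - 2) -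
        ((q : ℂ) + 1) * (2 * q - 1) * (4 * ∑ k ∈ range (n + 1), (q : ℂ) ^ k) := by
  have h := sub_one_mul_geom_sum_range_succ q n
  linear_combination (-4) * h

/-- **collar rows, `M`-form** (`q ≠ 0`): `2(qⁿ − q − 1)∕q² = ((q²+q−1)∕q³)·Y₀ + (−(q+1)(2q−1)∕(2q³))·Y₁`. [cite: Rogawski1990, §4.9 pp. 54–56] -/
theorem span_typeOne_collar {q : ℕ} (hq : q ≠ 0) (n : ℕ) :
    2 * ((q : ℂ) ^ n - q - 1) / (q : ℂ) ^ 2 =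
      (((q : ℂ) ^ 2 + q - 1) / (q : ℂ) ^ 3) * (4 * (∑ k ∈ range (n + 1), (q : ℂ) ^ k) - 2) +
        (-(((q : ℂ) + 1) * (2 * q - 1)) / (2 * (q : ℂ) ^ 3)) * (4 * ∑ k ∈ range (n + 1), (q : ℂ) ^ k) := by
  have hq' : (q : ℂ) ≠ 0 := Nat.cast_ne_zero.mpr hq
  have h := span_typeOne_collar_mul q n
  field_simp
  linear_combination h

/-- **deep row `0`, division-free**: `4(S − 1) = 2·Y₀ − Y₁` and `(q−1)·4(S−1) = 4q(qⁿ − 1)` (i.e. `q³·X̃_0` with `X̃_0 = 4(qⁿ−1)∕((q−1)q²)`). [cite: Rogawski1990, §4.9 pp. 54–56] -/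
theorem span_typeOne_deep_mul (q n : ℕ) :
    4 * ((∑ k ∈ range (n + 1), (q : ℂ) ^ k) - 1) =
        2 * (4 * (∑ k ∈ range (n + 1), (q : ℂ) ^ k) - 2) - (4 * ∑ k ∈ range (n + 1), (q : ℂ) ^ k) ∧
      ((q : ℂ) - 1) * (4 * ((∑ k ∈ range (n + 1), (q : ℂ) ^ k) - 1)) = 4 * q * ((q : ℂ) ^ n - 1) := by
  refine ⟨by ring, ?_⟩
  have h := sub_one_mul_geom_sum_range_succ q n
  linear_combination 4 * h

/-- **deep row, `M`-form** (`2 ≤ q`): `4(qⁿ − 1)∕((q−1)q²) = (2∕q³)·Y₀ + (−1∕q³)·Y₁`. [cite: Rogawski1990, §4.9 pp. 54–56] -/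
theorem span_typeOne_deep {q : ℕ} (hq : 2 ≤ q) (n : ℕ) :
    4 * ((q : ℂ) ^ n - 1) / (((q : ℂ) - 1) * (q : ℂ) ^ 2) =
      (2 / (q : ℂ) ^ 3) * (4 * (∑ k ∈ range (n + 1), (q : ℂ) ^ k) - 2) + (-1 / (q : ℂ) ^ 3) * (4 * ∑ k ∈ range (n + 1), (q : ℂ) ^ k) := by
  have hq0 : (q : ℂ) ≠ 0 := Nat.cast_ne_zero.mpr (by omega)
  have hq1 : (q : ℂ) - 1 ≠ 0 := by
    have h' : ((q - 1 : ℕ) : ℂ) ≠ 0 := Nat.cast_ne_zero.mpr (by omega)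
    rwa [Nat.cast_sub (by omega), Nat.cast_one] at h'
  have h := sub_one_mul_geom_sum_range_succ q n
  field_simp
  linear_combination (-4) * h

/-! ## §2 Type (2r) (`N = 2n+1`, ONE H-class): `m⁰ = 2S − 1`, `m♯ = 2S`; the profiles are HALF of type (1) -/

/-- **type (2r), all four rows, division-free**: `q·(2qⁿ) = −2m⁰ + (q+1)m♯`, `q²·(2qⁿ⁻¹) = −2m⁰ + (q+1)m♯` (`1 ≤ n`), `2q(qⁿ−q−1) = 2(q²+q−1)m⁰ − (q+1)(2q−1)m♯`,
`(q−1)·(2m⁰ − m♯)·… `: precisely `2(S−1) = 2m⁰ − m♯`. [cite: Rogawski1990, §4.9 pp. 54–56] -/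
theorem span_typeTwoRam_mul (q n : ℕ) :
    (q : ℂ) * (2 * (q : ℂ) ^ n) =
        (-2) * (2 * (∑ k ∈ range (n + 1), (q : ℂ) ^ k) - 1) + ((q : ℂ) + 1) * (2 * ∑ k ∈ range (n + 1), (q : ℂ) ^ k) ∧
      2 * (q : ℂ) * ((q : ℂ) ^ n - q - 1) =
        2 * ((q : ℂ) ^ 2 + q - 1) * (2 * (∑ k ∈ range (n + 1), (q : ℂ) ^ k) - 1) -
          ((q : ℂ) + 1) * (2 * q - 1) * (2 * ∑ k ∈ range (n + 1), (q : ℂ) ^ k) ∧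
      2 * ((∑ k ∈ range (n + 1), (q : ℂ) ^ k) - 1) =
        2 * (2 * (∑ k ∈ range (n + 1), (q : ℂ) ^ k) - 1) - (2 * ∑ k ∈ range (n + 1), (q : ℂ) ^ k) := by
  have h := sub_one_mul_geom_sum_range_succ q n
  exact ⟨by linear_combination (-2) * h, by linear_combination (-2) * h, by ring⟩

/-- **type (2r), `M`-form** (`2 ≤ q`): the four profiles `(2qⁿ, 2qⁿ∕q, (qⁿ−q−1)∕q², 2(qⁿ−1)∕((q−1)q²))` are `M·(m⁰, m♯)` with `m⁰ = 2S − 1`, `m♯ = 2S`. [cite: Rogawski1990, §4.9 pp. 54–56] -/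
theorem span_typeTwoRam {q : ℕ} (hq : 2 ≤ q) (n : ℕ) :
    (2 * (q : ℂ) ^ n =
        (-2 / (q : ℂ)) * (2 * (∑ k ∈ range (n + 1), (q : ℂ) ^ k) - 1) + (((q : ℂ) + 1) / q) * (2 * ∑ k ∈ range (n + 1), (q : ℂ) ^ k)) ∧
      (2 * (q : ℂ) ^ n / q =
        (-2 / (q : ℂ) ^ 2) * (2 * (∑ k ∈ range (n + 1), (q : ℂ) ^ k) - 1) + (((q : ℂ) + 1) / (q : ℂ) ^ 2) * (2 * ∑ k ∈ range (n + 1), (q : ℂ) ^ k)) ∧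
      (((q : ℂ) ^ n - q - 1) / (q : ℂ) ^ 2 =
        (((q : ℂ) ^ 2 + q - 1) / (q : ℂ) ^ 3) * (2 * (∑ k ∈ range (n + 1), (q : ℂ) ^ k) - 1) +
          (-(((q : ℂ) + 1) * (2 * q - 1)) / (2 * (q : ℂ) ^ 3)) * (2 * ∑ k ∈ range (n + 1), (q : ℂ) ^ k)) ∧
      (2 * ((q : ℂ) ^ n - 1) / (((q : ℂ) - 1) * (q : ℂ) ^ 2) =
        (2 / (q : ℂ) ^ 3) * (2 * (∑ k ∈ range (n + 1), (q : ℂ) ^ k) - 1) + (-1 / (q : ℂ) ^ 3) * (2 * ∑ k ∈ range (n + 1), (q : ℂ) ^ k)) := by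
  have hq0 : (q : ℂ) ≠ 0 := Nat.cast_ne_zero.mpr (by omega)
  have hq1 : (q : ℂ) - 1 ≠ 0 := by
    have h' : ((q - 1 : ℕ) : ℂ) ≠ 0 := Nat.cast_ne_zero.mpr (by omega)
    rwa [Nat.cast_sub (by omega), Nat.cast_one] at h'
  have h := sub_one_mul_geom_sum_range_succ q n
  refine ⟨?_, ?_, ?_, ?_⟩
  · field_simp; linear_combination (-1) * h
  · field_simp; linear_combination (-1) * h
  · field_simp; linear_combination (-1) * h
  · field_simp; linear_combination (-1) * h

/-! ## §3 Type (2u) (`N = 2n`, ONE H-class): `m⁰ = (q+1)T`, `m♯ = 1 + (q+1)T`, `T = Σ_{k<n} q^k` (vertex-centred ball of radius `n`) -/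

/-- `(q − 1)·Σ_{k < n} q^k = qⁿ − 1`. [cite: LabesseLanglands1979, §2 p. 8] -/
theorem sub_one_mul_geom_sum_range (q n : ℕ) :
    ((q : ℂ) - 1) * ∑ k ∈ range n, (q : ℂ) ^ k = (q : ℂ) ^ n - 1 := by
  rw [mul_comm]; exact geom_sum_mul (q : ℂ) n

/-- **type (2u), all four rows, division-free**: `q·X̃_bd = (q+1)qⁿ = −2m⁰ + (q+1)m♯`; `2q³·X̃_{1±} = (q+1)(qⁿ − 2q) = 2(q²+q−1)m⁰ − (q+1)(2q−1)m♯`;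
`q³·X̃_0 = (q+1)T − 1 = 2m⁰ − m♯`. [cite: Rogawski1990, §4.9 pp. 54–56] -/
theorem span_typeTwoUnr_mul (q n : ℕ) :
    ((q : ℂ) + 1) * (q : ℂ) ^ n =
        (-2) * (((q : ℂ) + 1) * ∑ k ∈ range n, (q : ℂ) ^ k) + ((q : ℂ) + 1) * (1 + ((q : ℂ) + 1) * ∑ k ∈ range n, (q : ℂ) ^ k) ∧
      ((q : ℂ) + 1) * ((q : ℂ) ^ n - 2 * q) =
        2 * ((q : ℂ) ^ 2 + q - 1) * (((q : ℂ) + 1) * ∑ k ∈ range n, (q : ℂ) ^ k) -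
          ((q : ℂ) + 1) * (2 * q - 1) * (1 + ((q : ℂ) + 1) * ∑ k ∈ range n, (q : ℂ) ^ k) ∧
      (((q : ℂ) + 1) * ∑ k ∈ range n, (q : ℂ) ^ k) - 1 =
        2 * (((q : ℂ) + 1) * ∑ k ∈ range n, (q : ℂ) ^ k) - (1 + ((q : ℂ) + 1) * ∑ k ∈ range n, (q : ℂ) ^ k) := by
  have h := sub_one_mul_geom_sum_range q n
  exact ⟨by linear_combination (-((q : ℂ) + 1)) * h, by linear_combination (-((q : ℂ) + 1)) * h, by ring⟩

/-- **type (2u), `M`-form** (`q ≠ 0`): `((q+1)qⁿ∕q, (q+1)qⁿ∕q², (q+1)(qⁿ−2q)∕(2q³), ((q+1)T−1)∕q³) = M·(m⁰, m♯)`. [cite: Rogawski1990, §4.9 pp. 54–56] -/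
theorem span_typeTwoUnr {q : ℕ} (hq : q ≠ 0) (n : ℕ) :
    (((q : ℂ) + 1) * (q : ℂ) ^ n / q =
        (-2 / (q : ℂ)) * (((q : ℂ) + 1) * ∑ k ∈ range n, (q : ℂ) ^ k) + (((q : ℂ) + 1) / q) * (1 + ((q : ℂ) + 1) * ∑ k ∈ range n, (q : ℂ) ^ k)) ∧
      (((q : ℂ) + 1) * (q : ℂ) ^ n / (q : ℂ) ^ 2 =
        (-2 / (q : ℂ) ^ 2) * (((q : ℂ) + 1) * ∑ k ∈ range n, (q : ℂ) ^ k) + (((q : ℂ) + 1) / (q : ℂ) ^ 2) * (1 + ((q : ℂ) + 1) * ∑ k ∈ range n, (q : ℂ) ^ k)) ∧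
      (((q : ℂ) + 1) * ((q : ℂ) ^ n - 2 * q) / (2 * (q : ℂ) ^ 3) =
        (((q : ℂ) ^ 2 + q - 1) / (q : ℂ) ^ 3) * (((q : ℂ) + 1) * ∑ k ∈ range n, (q : ℂ) ^ k) +
          (-(((q : ℂ) + 1) * (2 * q - 1)) / (2 * (q : ℂ) ^ 3)) * (1 + ((q : ℂ) + 1) * ∑ k ∈ range n, (q : ℂ) ^ k)) ∧
      (((((q : ℂ) + 1) * ∑ k ∈ range n, (q : ℂ) ^ k) - 1) / (q : ℂ) ^ 3 =
        (2 / (q : ℂ) ^ 3) * (((q : ℂ) + 1) * ∑ k ∈ range n, (q : ℂ) ^ k) + (-1 / (q : ℂ) ^ 3) * (1 + ((q : ℂ) + 1) * ∑ k ∈ range n, (q : ℂ) ^ k)) := by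
  have hq' : (q : ℂ) ≠ 0 := Nat.cast_ne_zero.mpr hq
  obtain ⟨h1, h2, h3⟩ := span_typeTwoUnr_mul q n
  have g := sub_one_mul_geom_sum_range q n
  refine ⟨?_, ?_, ?_, ?_⟩
  · field_simp; linear_combination h1 + (q : ℂ) * g
  · field_simp; linear_combination h1 + (q : ℂ) * g
  · field_simp; linear_combination h2 + (q : ℂ) * g
  · field_simp; linear_combination h3

/-! ## §4 The Levi row sums (`N`-strata volumes) and the column sums (fundamental-lemma check) of `M(q)` -/

/-- **Row sums of `M(q)` = the five `N`-strata volumes** `(1 − q⁻¹, q⁻¹(1 − q⁻¹), ½q⁻²(1 − q⁻¹), ½q⁻²(1 − q⁻¹), q⁻³)` of ★ `integral_eq_of_levelTwo_strata_of_ramified` (the Levi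
population of :118 has both H-columns equal per axis period, so only these sums enter). [cite: Rogawski1990, §4.9 pp. 54–56] -/
theorem transferMatrix_row_sums {q : ℕ} (hq : q ≠ 0) :
    (-2 / (q : ℂ) + ((q : ℂ) + 1) / q = 1 - ((q : ℂ))⁻¹) ∧
      (-2 / (q : ℂ) ^ 2 + ((q : ℂ) + 1) / (q : ℂ) ^ 2 = ((q : ℂ))⁻¹ * (1 - ((q : ℂ))⁻¹)) ∧
      (((q : ℂ) ^ 2 + q - 1) / (q : ℂ) ^ 3 + -(((q : ℂ) + 1) * (2 * q - 1)) / (2 * (q : ℂ) ^ 3) = (1 / 2) * ((q : ℂ))⁻¹ ^ 2 * (1 - ((q : ℂ))⁻¹)) ∧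
      (2 / (q : ℂ) ^ 3 + -1 / (q : ℂ) ^ 3 = ((q : ℂ))⁻¹ ^ 3) := by
  have hq' : (q : ℂ) ≠ 0 := Nat.cast_ne_zero.mpr hq
  refine ⟨?_, ?_, ?_, ?_⟩ <;> field_simp <;> ring

/-- **Column sums of `M(q)`** over the five strata (the two collar rows counted separately): `Σ_j M_{j,0} = 0` and `Σ_j M_{j,1} = 1` — the exact fundamental-lemma identity
`Σ_j X̃_j = Y₁` («K-FL», 57∕57 + 28∕28 rows of the certificates). [cite: Rogawski1990, §4.9 pp. 54–56] -/
theorem transferMatrix_column_sums {q : ℕ} (hq : q ≠ 0) :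
    (-2 / (q : ℂ) + -2 / (q : ℂ) ^ 2 + 2 * (((q : ℂ) ^ 2 + q - 1) / (q : ℂ) ^ 3) + 2 / (q : ℂ) ^ 3 = 0) ∧
      (((q : ℂ) + 1) / q + ((q : ℂ) + 1) / (q : ℂ) ^ 2 + 2 * (-(((q : ℂ) + 1) * (2 * q - 1)) / (2 * (q : ℂ) ^ 3)) + -1 / (q : ℂ) ^ 3 = 1) := by
  have hq' : (q : ℂ) ≠ 0 := Nat.cast_ne_zero.mpr hq
  refine ⟨?_, ?_⟩ <;> field_simp <;> ring

/-! ## §5 The LEVI ROW of `M(q)` with column masses (ED. 2, B-p14 (g39); ref5 (g4) R-275)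

The (e3) Levi population of fold v6 :118 cuts against the SAME coefficient pair `a_s(c) = κ_s·Σ_j c_j·M_{j,s}` (`s = 0` the `K⁰`-column, `s = 1` the
`K♯`-column) as the type-(1) clause, and on Levi classes `Φ^st(χ♯) = ((q+1)∕2)·Φ^st(χ₀)` (★ `stableOrbitalIntegralRel_chiSharp_eq_mul_chiZero_of_levi_ramified`,
F0P3a-p07 (g13)); the Levi G-side is `κ_L·Σ_j c_j·w_j` with `w` the five `N`-strata volumes (★ `integral_eq_of_levelTwo_strata_of_ramified`; §4 above).  So the Levi
population tests `M(q)` through ONE scalar identity per stratum, **`κ₀·M_{j,0} + ((q+1)∕2)·κ₁·M_{j,1} = κ_L·w_j`**.  Since `M_{j,0} + M_{j,1} = w_j` (§4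
`transferMatrix_row_sums`), the five identities hold as soon as `κ₀ = κ_L` and `((q+1)∕2)·κ₁ = κ_L` (`transferMatrix_leviRow`, and the strata-summed form
`transferMatrix_leviRow_sum`), and CONVERSELY the `bd` and deep rows alone force these two mass equalities (`masses_of_transferMatrix_leviRow`): the JOIN pins the
`K♯`-mass to `κ₁ = 2κ₀∕(q+1)` and the Levi normalisation to `κ_L = κ₀`.  All masses are SYMBOLS here (pure arithmetic over `ℂ`). -/

/-- **THE LEVI ROW OF `M(q)`, GIVEN THE MASSES**: if `κ₀ = κ_L` and `((q+1)∕2)·κ₁ = κ_L` then, for each of the rows `bd`, `reg`, `1± (collar)`, `0 (deep)` of `M(q)`,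
`κ₀·M_{j,0} + ((q+1)∕2)·κ₁·M_{j,1} = κ_L·w_j` with `w = (1 − q⁻¹, q⁻¹(1 − q⁻¹), ½q⁻²(1 − q⁻¹), q⁻³)` the `N`-strata volumes of §4 (ref5 (g4) R-275's scalar identity).
[cite: Rogawski1990, §4.9 Prop. 4.9.1 (b) p. 55, pp. 54–56] -/
theorem transferMatrix_leviRow {q : ℕ} (hq : q ≠ 0) {κ₀ κ₁ κL : ℂ} (h₀ : κ₀ = κL) (h₁ : ((q : ℂ) + 1) / 2 * κ₁ = κL) :
    (κ₀ * (-2 / (q : ℂ)) + ((q : ℂ) + 1) / 2 * κ₁ * (((q : ℂ) + 1) / q) = κL * (1 - ((q : ℂ))⁻¹)) ∧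
      (κ₀ * (-2 / (q : ℂ) ^ 2) + ((q : ℂ) + 1) / 2 * κ₁ * (((q : ℂ) + 1) / (q : ℂ) ^ 2) = κL * (((q : ℂ))⁻¹ * (1 - ((q : ℂ))⁻¹))) ∧
      (κ₀ * (((q : ℂ) ^ 2 + q - 1) / (q : ℂ) ^ 3) + ((q : ℂ) + 1) / 2 * κ₁ * (-(((q : ℂ) + 1) * (2 * q - 1)) / (2 * (q : ℂ) ^ 3)) =
        κL * ((1 / 2) * ((q : ℂ))⁻¹ ^ 2 * (1 - ((q : ℂ))⁻¹))) ∧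
      (κ₀ * (2 / (q : ℂ) ^ 3) + ((q : ℂ) + 1) / 2 * κ₁ * (-1 / (q : ℂ) ^ 3) = κL * ((q : ℂ))⁻¹ ^ 3) := by
  have hq' : (q : ℂ) ≠ 0 := Nat.cast_ne_zero.mpr hq
  rw [h₁, h₀]
  refine ⟨?_, ?_, ?_, ?_⟩ <;> field_simp <;> ring

/-- **THE LEVI ROW, STRATA-SUMMED**: for arbitrary strata values `c = (c_bd, c_reg, c₁₊, c₁₋, c₀)` of the piece, with `a_s(c) = κ_s·Σ_j c_j·M_{j,s}` and the masses as in
`transferMatrix_leviRow`, `a₀(c) + ((q+1)∕2)·a₁(c) = κ_L·Σ_j c_j·w_j` — the form in which the Levi clause (h₃) of fold v6 :118 consumes `M(q)`.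
[cite: Rogawski1990, §4.9 Prop. 4.9.1 (b) p. 55, pp. 54–56] -/
theorem transferMatrix_leviRow_sum {q : ℕ} (hq : q ≠ 0) {κ₀ κ₁ κL : ℂ} (h₀ : κ₀ = κL) (h₁ : ((q : ℂ) + 1) / 2 * κ₁ = κL)
    (cbd creg cp cm c0 : ℂ) :
    κ₀ * (cbd * (-2 / (q : ℂ)) + creg * (-2 / (q : ℂ) ^ 2) + cp * (((q : ℂ) ^ 2 + q - 1) / (q : ℂ) ^ 3) + cm * (((q : ℂ) ^ 2 + q - 1) / (q : ℂ) ^ 3) +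
          c0 * (2 / (q : ℂ) ^ 3)) +
        ((q : ℂ) + 1) / 2 * κ₁ * (cbd * (((q : ℂ) + 1) / q) + creg * (((q : ℂ) + 1) / (q : ℂ) ^ 2) + cp * (-(((q : ℂ) + 1) * (2 * q - 1)) / (2 * (q : ℂ) ^ 3)) +
          cm * (-(((q : ℂ) + 1) * (2 * q - 1)) / (2 * (q : ℂ) ^ 3)) + c0 * (-1 / (q : ℂ) ^ 3)) =
      κL * (cbd * (1 - ((q : ℂ))⁻¹) + creg * (((q : ℂ))⁻¹ * (1 - ((q : ℂ))⁻¹)) + cp * ((1 / 2) * ((q : ℂ))⁻¹ ^ 2 * (1 - ((q : ℂ))⁻¹)) +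
        cm * ((1 / 2) * ((q : ℂ))⁻¹ ^ 2 * (1 - ((q : ℂ))⁻¹)) + c0 * ((q : ℂ))⁻¹ ^ 3) := by
  have hq' : (q : ℂ) ≠ 0 := Nat.cast_ne_zero.mpr hq
  rw [h₁, h₀]
  field_simp
  ring

/-- **THE JOIN PINS THE MASSES** (converse of `transferMatrix_leviRow`): if the Levi row identity `κ₀·M_{j,0} + λ·M_{j,1} = κ_L·w_j` holds for the `bd` row and for the deep
row `0` of `M(q)` (`q ≠ 0`), then `κ₀ = κ_L` and `λ = κ_L` — i.e. with `λ = ((q+1)∕2)·κ₁` the `K♯`-column mass is forced to `κ₁ = 2κ₀∕(q+1)` and the Levi normalisation to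
`κ_L = κ₀`. [cite: Rogawski1990, §4.9 Prop. 4.9.1 (b) p. 55, pp. 54–56] -/
theorem masses_of_transferMatrix_leviRow {q : ℕ} (hq : q ≠ 0) {κ₀ lam κL : ℂ}
    (hbd : κ₀ * (-2 / (q : ℂ)) + lam * (((q : ℂ) + 1) / q) = κL * (1 - ((q : ℂ))⁻¹))
    (h0 : κ₀ * (2 / (q : ℂ) ^ 3) + lam * (-1 / (q : ℂ) ^ 3) = κL * ((q : ℂ))⁻¹ ^ 3) :
    κ₀ = κL ∧ lam = κL := by
  have hq' : (q : ℂ) ≠ 0 := Nat.cast_ne_zero.mpr hq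
  have l1 : (q : ℂ) * (κ₀ * (-2 / (q : ℂ)) + lam * (((q : ℂ) + 1) / q)) = -2 * κ₀ + ((q : ℂ) + 1) * lam := by
    field_simp
  have r1 : (q : ℂ) * (κL * (1 - ((q : ℂ))⁻¹)) = ((q : ℂ) - 1) * κL := by
    field_simp
  have l2 : (q : ℂ) ^ 3 * (κ₀ * (2 / (q : ℂ) ^ 3) + lam * (-1 / (q : ℂ) ^ 3)) = 2 * κ₀ - lam := by
    field_simp
    ring
  have r2 : (q : ℂ) ^ 3 * (κL * ((q : ℂ))⁻¹ ^ 3) = κL := by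
    field_simp
  have e1 : -2 * κ₀ + ((q : ℂ) + 1) * lam = ((q : ℂ) - 1) * κL := by rw [← l1, hbd, r1]
  have e2 : 2 * κ₀ - lam = κL := by rw [← l2, h0, r2]
  have hl : lam = κL := by
    have h : (q : ℂ) * lam = (q : ℂ) * κL := by linear_combination e1 + e2
    exact mul_left_cancel₀ hq' h
  exact ⟨by linear_combination (1 / 2 : ℂ) * e2 + (1 / 2 : ℂ) * hl, hl⟩

/-! ## §6 Type (1) with GENERAL strata values and a symbolic `K♯`-mass: the span in the shape of the `(ha)` binder of the matrix head -/

/-- **TYPE-(1) SPAN FOR ARBITRARY STRATA VALUES** (`2 ≤ q`, `1 ≤ n`, `N = 2n+1`): for a piece with strata values `c = (c_bd, c_reg, c₁₊, c₁₋, c₀)` and any constant `C`,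
`C·Σ_j c_j·X̃_j(n) = a₀(c)·Y₀ + a₁(c)·Y₁` with `a_s(c) = C·Σ_j c_j·M_{j,s}` EXPLICIT and `Y₀ = 4S − 2`, `Y₁ = 4S` (`S = Σ_{k ≤ n} q^k`, the type-(1) H-profiles in the normal
form of ★ `hProfile_zero∕one_closedForm_of_odd`) — the five §1 row identities summed; this is the `X N = Σ_s a s·Y s N` shape of the span binder `(ha)` of the type-(1)
matrix head once the closed forms are substituted. [cite: Rogawski1990, §4.9 Prop. 4.9.1 (a)(b) p. 55, pp. 54–56] [cite: LabesseLanglands1979, §2 p. 8] -/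
theorem span_typeOne_of_strata_values {q : ℕ} (hq : 2 ≤ q) {n : ℕ} (hn : 1 ≤ n) (C cbd creg cp cm c0 : ℂ) :
    C * (cbd * (4 * (q : ℂ) ^ n) + creg * (4 * (q : ℂ) ^ (n - 1)) + cp * (2 * ((q : ℂ) ^ n - q - 1) / (q : ℂ) ^ 2) +
          cm * (2 * ((q : ℂ) ^ n - q - 1) / (q : ℂ) ^ 2) + c0 * (4 * ((q : ℂ) ^ n - 1) / (((q : ℂ) - 1) * (q : ℂ) ^ 2))) =
      C * (cbd * (-2 / (q : ℂ)) + creg * (-2 / (q : ℂ) ^ 2) + cp * (((q : ℂ) ^ 2 + q - 1) / (q : ℂ) ^ 3) + cm * (((q : ℂ) ^ 2 + q - 1) / (q : ℂ) ^ 3) +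
            c0 * (2 / (q : ℂ) ^ 3)) *
          (4 * (∑ k ∈ range (n + 1), (q : ℂ) ^ k) - 2) +
        C * (cbd * (((q : ℂ) + 1) / q) + creg * (((q : ℂ) + 1) / (q : ℂ) ^ 2) + cp * (-(((q : ℂ) + 1) * (2 * q - 1)) / (2 * (q : ℂ) ^ 3)) +
            cm * (-(((q : ℂ) + 1) * (2 * q - 1)) / (2 * (q : ℂ) ^ 3)) + c0 * (-1 / (q : ℂ) ^ 3)) *
          (4 * ∑ k ∈ range (n + 1), (q : ℂ) ^ k) := by
  have hq0 : q ≠ 0 := by omega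
  rw [span_typeOne_bd hq0 n, span_typeOne_reg hq0 hn, span_typeOne_collar hq0 n, span_typeOne_deep hq n]
  ring

/-- **THE SAME WITH A SYMBOLIC `K♯`-MASS `ρ ≠ 0`**: if the second H-profile is carried as `ρ·Y₁` (a volume ratio `ρ = ν_H(K♯ × U₁)∕ν_H(K_H)` kept symbolic, as in ★
`DepthZeroTransferHValuesTypeOneRamified`), the coefficients are `a₀(c) = C·Σ_j c_j M_{j,0}` and `a₁(c) = (C∕ρ)·Σ_j c_j M_{j,1}` — the per-column-mass edition
`a_s(c) = κ_s·Σ_j c_j M_{j,s}`, `κ₁ = κ₀∕ρ`. [cite: Rogawski1990, §4.9 Prop. 4.9.1 (a)(b) p. 55, pp. 54–56] [cite: LabesseLanglands1979, §2 p. 8] -/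
theorem span_typeOne_of_strata_values_mass {q : ℕ} (hq : 2 ≤ q) {n : ℕ} (hn : 1 ≤ n) (C cbd creg cp cm c0 : ℂ) {ρ : ℂ} (hρ : ρ ≠ 0) :
    C * (cbd * (4 * (q : ℂ) ^ n) + creg * (4 * (q : ℂ) ^ (n - 1)) + cp * (2 * ((q : ℂ) ^ n - q - 1) / (q : ℂ) ^ 2) +
          cm * (2 * ((q : ℂ) ^ n - q - 1) / (q : ℂ) ^ 2) + c0 * (4 * ((q : ℂ) ^ n - 1) / (((q : ℂ) - 1) * (q : ℂ) ^ 2))) =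
      C * (cbd * (-2 / (q : ℂ)) + creg * (-2 / (q : ℂ) ^ 2) + cp * (((q : ℂ) ^ 2 + q - 1) / (q : ℂ) ^ 3) + cm * (((q : ℂ) ^ 2 + q - 1) / (q : ℂ) ^ 3) +
            c0 * (2 / (q : ℂ) ^ 3)) *
          (4 * (∑ k ∈ range (n + 1), (q : ℂ) ^ k) - 2) +
        C / ρ * (cbd * (((q : ℂ) + 1) / q) + creg * (((q : ℂ) + 1) / (q : ℂ) ^ 2) + cp * (-(((q : ℂ) + 1) * (2 * q - 1)) / (2 * (q : ℂ) ^ 3)) +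
            cm * (-(((q : ℂ) + 1) * (2 * q - 1)) / (2 * (q : ℂ) ^ 3)) + c0 * (-1 / (q : ℂ) ^ 3)) *
          (ρ * (4 * ∑ k ∈ range (n + 1), (q : ℂ) ^ k)) := by
  rw [span_typeOne_of_strata_values hq hn]
  congr 1
  field_simp

/-- The `Fin 2`-sum packaging used by the matrix head: `Σ_{s : Fin 2} (![a₀, a₁] s)·(![Y₀, Y₁] s) = a₀·Y₀ + a₁·Y₁`. [cite: Rogawski1990, §4.9 Prop. 4.9.1 (b) p. 55] -/
theorem sum_univ_fin_two_vecCons_mul_vecCons (a₀ a₁ Y₀ Y₁ : ℂ) :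
    ∑ s : Fin 2, (![a₀, a₁] : Fin 2 → ℂ) s * (![Y₀, Y₁] : Fin 2 → ℂ) s = a₀ * Y₀ + a₁ * Y₁ := by
  simp [Fin.sum_univ_two]

/-! ## §7 Type (2r) and (2u) with GENERAL strata values (ED. 3, B-p14 (g39)): the explicit `a_s(c) = κ_s·Σ_j c_j·M_{j,s}` currency for the (α₂) stub C₂′ ∕ fold v7 `stub_typeTwo_ram` (ref5 (g4) R-279∕R-283)

Same matrix `M(q)`, ONE H-class: type (2r) (`N = 2n+1`; `m⁰ = 2S − 1`, `m♯ = 2S`, `S = Σ_{k ≤ n} q^k`; G-profiles `(2qⁿ, 2qⁿ∕q, (qⁿ−q−1)∕q² ×2, 2(qⁿ−1)∕((q−1)q²))`, §2) and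
type (2u) (`N = 2n`; `m⁰ = (q+1)T`, `m♯ = 1 + (q+1)T`, `T = Σ_{k < n} q^k`; G-profiles `((q+1)qⁿ∕q, (q+1)qⁿ∕q², (q+1)(qⁿ−2q)∕(2q³) ×2, ((q+1)T − 1)∕q³)`, §3): for arbitrary strata values
`c` and constant `C`, `C·Σ_j c_j·X̃_j = (C·Σ_j c_j M_{j,0})·m⁰ + (C·Σ_j c_j M_{j,1})·m♯`, and the edition with a symbolic `K♯`-mass `ρ ≠ 0` (`κ₁ = κ₀∕ρ`). -/

/-- **TYPE-(2r) SPAN FOR ARBITRARY STRATA VALUES** (`2 ≤ q`, `N = 2n+1`, one H-class): `C·Σ_j c_j·X̃_j(n) = (C·Σ_j c_j M_{j,0})·(2S − 1) + (C·Σ_j c_j M_{j,1})·(2S)` — §2's four rows summed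
with weights `c = (c_bd, c_reg, c₁₊, c₁₋, c₀)`. [cite: Rogawski1990, §4.9 Prop. 4.9.1 (a)(b) p. 55, pp. 54–56] [cite: LabesseLanglands1979, §2 p. 8] -/
theorem span_typeTwoRam_of_strata_values {q : ℕ} (hq : 2 ≤ q) (n : ℕ) (C cbd creg cp cm c0 : ℂ) :
    C * (cbd * (2 * (q : ℂ) ^ n) + creg * (2 * (q : ℂ) ^ n / q) + cp * (((q : ℂ) ^ n - q - 1) / (q : ℂ) ^ 2) + cm * (((q : ℂ) ^ n - q - 1) / (q : ℂ) ^ 2) +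
          c0 * (2 * ((q : ℂ) ^ n - 1) / (((q : ℂ) - 1) * (q : ℂ) ^ 2))) =
      C * (cbd * (-2 / (q : ℂ)) + creg * (-2 / (q : ℂ) ^ 2) + cp * (((q : ℂ) ^ 2 + q - 1) / (q : ℂ) ^ 3) + cm * (((q : ℂ) ^ 2 + q - 1) / (q : ℂ) ^ 3) +
            c0 * (2 / (q : ℂ) ^ 3)) *
          (2 * (∑ k ∈ range (n + 1), (q : ℂ) ^ k) - 1) +
        C * (cbd * (((q : ℂ) + 1) / q) + creg * (((q : ℂ) + 1) / (q : ℂ) ^ 2) + cp * (-(((q : ℂ) + 1) * (2 * q - 1)) / (2 * (q : ℂ) ^ 3)) +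
            cm * (-(((q : ℂ) + 1) * (2 * q - 1)) / (2 * (q : ℂ) ^ 3)) + c0 * (-1 / (q : ℂ) ^ 3)) *
          (2 * ∑ k ∈ range (n + 1), (q : ℂ) ^ k) := by
  obtain ⟨h1, h2, h3, h4⟩ := span_typeTwoRam hq n
  linear_combination C * cbd * h1 + C * creg * h2 + (C * cp + C * cm) * h3 + C * c0 * h4

/-- **TYPE-(2r) SPAN WITH A SYMBOLIC `K♯`-MASS `ρ ≠ 0`**: the second H-profile carried as `ρ·m♯`; coefficients `a₀(c) = C·Σ_j c_j M_{j,0}`, `a₁(c) = (C∕ρ)·Σ_j c_j M_{j,1}`.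
[cite: Rogawski1990, §4.9 Prop. 4.9.1 (a)(b) p. 55, pp. 54–56] [cite: LabesseLanglands1979, §2 p. 8] -/
theorem span_typeTwoRam_of_strata_values_mass {q : ℕ} (hq : 2 ≤ q) (n : ℕ) (C cbd creg cp cm c0 : ℂ) {ρ : ℂ} (hρ : ρ ≠ 0) :
    C * (cbd * (2 * (q : ℂ) ^ n) + creg * (2 * (q : ℂ) ^ n / q) + cp * (((q : ℂ) ^ n - q - 1) / (q : ℂ) ^ 2) + cm * (((q : ℂ) ^ n - q - 1) / (q : ℂ) ^ 2) +
          c0 * (2 * ((q : ℂ) ^ n - 1) / (((q : ℂ) - 1) * (q : ℂ) ^ 2))) =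
      C * (cbd * (-2 / (q : ℂ)) + creg * (-2 / (q : ℂ) ^ 2) + cp * (((q : ℂ) ^ 2 + q - 1) / (q : ℂ) ^ 3) + cm * (((q : ℂ) ^ 2 + q - 1) / (q : ℂ) ^ 3) +
            c0 * (2 / (q : ℂ) ^ 3)) *
          (2 * (∑ k ∈ range (n + 1), (q : ℂ) ^ k) - 1) +
        C / ρ * (cbd * (((q : ℂ) + 1) / q) + creg * (((q : ℂ) + 1) / (q : ℂ) ^ 2) + cp * (-(((q : ℂ) + 1) * (2 * q - 1)) / (2 * (q : ℂ) ^ 3)) +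
            cm * (-(((q : ℂ) + 1) * (2 * q - 1)) / (2 * (q : ℂ) ^ 3)) + c0 * (-1 / (q : ℂ) ^ 3)) *
          (ρ * (2 * ∑ k ∈ range (n + 1), (q : ℂ) ^ k)) := by
  rw [span_typeTwoRam_of_strata_values hq n]
  congr 1
  field_simp

/-- **TYPE-(2u) SPAN FOR ARBITRARY STRATA VALUES** (`q ≠ 0`, `N = 2n`, one H-class, `T = Σ_{k < n} q^k`): `C·Σ_j c_j·X̃_j(n) = (C·Σ_j c_j M_{j,0})·((q+1)T) + (C·Σ_j c_j M_{j,1})·(1 + (q+1)T)`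
— §3's four rows summed. [cite: Rogawski1990, §4.9 Prop. 4.9.1 (a)(b) p. 55, pp. 54–56] [cite: LabesseLanglands1979, §2 p. 8] -/
theorem span_typeTwoUnr_of_strata_values {q : ℕ} (hq : q ≠ 0) (n : ℕ) (C cbd creg cp cm c0 : ℂ) :
    C * (cbd * (((q : ℂ) + 1) * (q : ℂ) ^ n / q) + creg * (((q : ℂ) + 1) * (q : ℂ) ^ n / (q : ℂ) ^ 2) + cp * (((q : ℂ) + 1) * ((q : ℂ) ^ n - 2 * q) / (2 * (q : ℂ) ^ 3)) +
          cm * (((q : ℂ) + 1) * ((q : ℂ) ^ n - 2 * q) / (2 * (q : ℂ) ^ 3)) + c0 * (((((q : ℂ) + 1) * ∑ k ∈ range n, (q : ℂ) ^ k) - 1) / (q : ℂ) ^ 3)) =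
      C * (cbd * (-2 / (q : ℂ)) + creg * (-2 / (q : ℂ) ^ 2) + cp * (((q : ℂ) ^ 2 + q - 1) / (q : ℂ) ^ 3) + cm * (((q : ℂ) ^ 2 + q - 1) / (q : ℂ) ^ 3) +
            c0 * (2 / (q : ℂ) ^ 3)) *
          (((q : ℂ) + 1) * ∑ k ∈ range n, (q : ℂ) ^ k) +
        C * (cbd * (((q : ℂ) + 1) / q) + creg * (((q : ℂ) + 1) / (q : ℂ) ^ 2) + cp * (-(((q : ℂ) + 1) * (2 * q - 1)) / (2 * (q : ℂ) ^ 3)) +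
            cm * (-(((q : ℂ) + 1) * (2 * q - 1)) / (2 * (q : ℂ) ^ 3)) + c0 * (-1 / (q : ℂ) ^ 3)) *
          (1 + ((q : ℂ) + 1) * ∑ k ∈ range n, (q : ℂ) ^ k) := by
  obtain ⟨h1, h2, h3, h4⟩ := span_typeTwoUnr hq n
  linear_combination C * cbd * h1 + C * creg * h2 + (C * cp + C * cm) * h3 + C * c0 * h4

/-- **TYPE-(2u) SPAN WITH A SYMBOLIC `K♯`-MASS `ρ ≠ 0`**: coefficients `a₀(c) = C·Σ_j c_j M_{j,0}`, `a₁(c) = (C∕ρ)·Σ_j c_j M_{j,1}` against `(m⁰, ρ·m♯)`.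
[cite: Rogawski1990, §4.9 Prop. 4.9.1 (a)(b) p. 55, pp. 54–56] [cite: LabesseLanglands1979, §2 p. 8] -/
theorem span_typeTwoUnr_of_strata_values_mass {q : ℕ} (hq : q ≠ 0) (n : ℕ) (C cbd creg cp cm c0 : ℂ) {ρ : ℂ} (hρ : ρ ≠ 0) :
    C * (cbd * (((q : ℂ) + 1) * (q : ℂ) ^ n / q) + creg * (((q : ℂ) + 1) * (q : ℂ) ^ n / (q : ℂ) ^ 2) + cp * (((q : ℂ) + 1) * ((q : ℂ) ^ n - 2 * q) / (2 * (q : ℂ) ^ 3)) +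
          cm * (((q : ℂ) + 1) * ((q : ℂ) ^ n - 2 * q) / (2 * (q : ℂ) ^ 3)) + c0 * (((((q : ℂ) + 1) * ∑ k ∈ range n, (q : ℂ) ^ k) - 1) / (q : ℂ) ^ 3)) =
      C * (cbd * (-2 / (q : ℂ)) + creg * (-2 / (q : ℂ) ^ 2) + cp * (((q : ℂ) ^ 2 + q - 1) / (q : ℂ) ^ 3) + cm * (((q : ℂ) ^ 2 + q - 1) / (q : ℂ) ^ 3) +
            c0 * (2 / (q : ℂ) ^ 3)) *
          (((q : ℂ) + 1) * ∑ k ∈ range n, (q : ℂ) ^ k) +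
        C / ρ * (cbd * (((q : ℂ) + 1) / q) + creg * (((q : ℂ) + 1) / (q : ℂ) ^ 2) + cp * (-(((q : ℂ) + 1) * (2 * q - 1)) / (2 * (q : ℂ) ^ 3)) +
            cm * (-(((q : ℂ) + 1) * (2 * q - 1)) / (2 * (q : ℂ) ^ 3)) + c0 * (-1 / (q : ℂ) ^ 3)) *
          (ρ * (1 + ((q : ℂ) + 1) * ∑ k ∈ range n, (q : ℂ) ^ k)) := by
  rw [span_typeTwoUnr_of_strata_values hq n]
  congr 1
  field_simp

end Literature.NumberTheory.Rogawski1990
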